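import Literature.MathematicalPhysics.QuantumLattice.TorusPlaquettePartition
import Literature.MathematicalPhysics.QuantumLattice.SourcedHubbardBlockCut
import HarnessLib

/-!
# The intra-plaquette Hubbard Hamiltonian of the checkerboard torus is the sum of the embedded
# plaquette Hamiltonians

In the statements of the Hubbard summit (routes PlaquetteBoson / AnisotropyChord / LevyLogBootstrap /
PolyaSchurPairBoson) the checkerboard Hubbard torus of side `L = 2M` is
`hamiltonian G_intra 1 U + hamiltonian G_inter t' 0` with
`G_intra = fermionTorusGraph 2 L \ SimpleGraph.comap (fun x i => (x i : ℕ)/2) ⊤` (bonds inside a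
`2 × 2` block) and `G_inter = fermionTorusGraph 2 L ⊓ SimpleGraph.comap (…) ⊤`. PROVED here, for
`M ≥ 2`, with the plaquette partition of `TorusPlaquettePartition`:

* `intraGraph_adj_plaqSite_iff`: two sites `2R + a`, `2R + b` of the same plaquette are adjacent in
  `G_intra` iff `a`, `b` are adjacent in the plaquette graph `C₄` (no wrap-around inside a block
  when `L ≥ 4`);
* `intraGraph_adj_imp_blockOf_eq` / adjacency in `G_intra` forces a common block;
* **`hamiltonian_intraGraph_eq_sum_jwEmbed`**:
  `hamiltonian G_intra t U = Σ_R jwEmbed (plaqOrbEmb M R) (hamiltonian plaquetteGraph t U)` —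
  the decoupled plaquettes are literally the sum of the second-quantised one-plaquette Hamiltonians
  (block cut of `SourcedHubbardBlockCut` with no boundary bonds and no atomic rest), in particular
  `hamiltonian G_intra 1 U = Σ_R jwEmbed (plaqOrbEmb M R) (plaquetteHamiltonian U)`.

With `ClusterProductStates.jwEmbed_mulVec_prodFamily` this gives the plaquette-wise action of
`H_intra` on product states of plaquette vectors (the `E₀(N_b)`-eigenvector clause of the
plaquette-boson dictionary). References: W.-F. Tsai, S. A. Kivelson, PRB 73 (2006) 214510, §I;
H. Yao, W.-F. Tsai, S. A. Kivelson, PRB 76 (2007) 161104(R), eq. (1), Fig. 1 [YaoTsaiKivelson2007];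
D. Ruelle, *Statistical Mechanics* (1969) §2.2 (block decompositions) [Ruelle1969]. Tree:
`sourced_sub_sum_jwEmbed_sub_onSiteSum_eq` (`SourcedHubbardBlockCut`), `torusGraph_adj_iff`,
`plaquetteGraph_adj_iff`, `TorusPlaquette.*`.
-/

noncomputable section

namespace Literature.MathematicalPhysics.QuantumLattice

open Matrix Finset Literature.Probability.LatticeModels

namespace TorusPlaquette

variable (M : ℕ)

/-- The intra-plaquette graph of the `2M`-torus: torus bonds joining sites of the same block, as
written in the summit's statements. [cite: YaoTsaiKivelson2007, eq. (1)] -/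
def intraGraph : SimpleGraph (FermionTorus 2 (2 * M)) :=
  fermionTorusGraph 2 (2 * M) \
    SimpleGraph.comap (fun x : FermionTorus 2 (2 * M) => fun i : Fin 2 => ((ofLex x) i : ℕ) / 2) ⊤

/-- `intraGraph` is the summit's `G \ comap ⊤` (definitional). [folklore] -/
theorem intraGraph_eq :
    intraGraph M = fermionTorusGraph 2 (2 * M) \
      SimpleGraph.comap (fun x : FermionTorus 2 (2 * M) => fun i : Fin 2 => ((ofLex x) i : ℕ) / 2) ⊤ := rfl

/-- Adjacency in the intra-plaquette graph is decidable (Mathlib's instances for `\\` and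
`comap`). [folklore] -/
instance instDecidableRelIntraGraphAdj : DecidableRel (intraGraph M).Adj := by
  unfold intraGraph; infer_instance

/-- Adjacency in the intra-plaquette graph: torus adjacency AND same block. [folklore] -/
theorem intraGraph_adj (x y : FermionTorus 2 (2 * M)) :
    (intraGraph M).Adj x y ↔ (fermionTorusGraph 2 (2 * M)).Adj x y ∧ blockOf M x = blockOf M y := by
  rw [intraGraph, SimpleGraph.sdiff_adj, SimpleGraph.comap_adj, SimpleGraph.top_adj, not_not,
    blockOf_eq_iff]

/-- Adjacent sites of the intra-plaquette graph lie in a common block. [folklore] -/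
theorem intraGraph_adj_imp_blockOf_eq {x y : FermionTorus 2 (2 * M)} (h : (intraGraph M).Adj x y) :
    blockOf M x = blockOf M y :=
  ((intraGraph_adj M x y).1 h).2

/-! ### Torus adjacency inside one block -/

/-- Casting bounded naturals into `ZMod L` is injective below `L`. [folklore] -/
theorem natCast_zmod_eq_iff_of_lt {L n m : ℕ} (hn : n < L) (hm : m < L) :
    ((n : ℕ) : ZMod L) = ((m : ℕ) : ZMod L) ↔ n = m := by
  rw [ZMod.natCast_eq_natCast_iff', Nat.mod_eq_of_lt hn, Nat.mod_eq_of_lt hm]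

/-- Inside a block of a torus of side `L ≥ 3`: `2r + b ≡ 2r + a + 1 (mod L)` with `a, b ≤ 1` forces
`a = 0`, `b = 1` (no wrap-around). [folklore] -/
theorem step_in_block {L r a b : ℕ} (hL : 3 ≤ L) (hr : 2 * r + 1 < L) (ha : a ≤ 1) (hb : b ≤ 1)
    (h : ((2 * r + b : ℕ) : ZMod L) = ((2 * r + a : ℕ) : ZMod L) + 1) : a = 0 ∧ b = 1 := by
  have h' : ((2 * r + b : ℕ) : ZMod L) = ((2 * r + a + 1 : ℕ) : ZMod L) := by
    rw [h]; push_cast; ring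
  rw [ZMod.natCast_eq_natCast_iff', Nat.mod_eq_of_lt (by omega)] at h'
  by_cases hlt : 2 * r + a + 1 < L
  · rw [Nat.mod_eq_of_lt hlt] at h'
    omega
  · have heq : 2 * r + a + 1 = L := by omega
    rw [heq, Nat.mod_self] at h'
    omega

variable {M}

/-- The coordinates of a plaquette site are below `L = 2M`, with room for the `+1` step.
[folklore] -/
theorem two_mul_add_lt (R : FermionTorus 2 M) (i : Fin 2) : 2 * (ofLex R i : ℕ) + 1 < 2 * M := by
  have h := (ofLex R i).isLt
  omega

/-- **Adjacency of two sites of one plaquette** (`M ≥ 2`): `2R + a ∼ 2R + b` on the torus iff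
`a ∼ b` in the plaquette graph `C₄`. [cite: YaoTsaiKivelson2007, Fig. 1] -/
theorem fermionTorusGraph_adj_plaqSite_iff (hM : 2 ≤ M) (R : FermionTorus 2 M) (a b : PlaquetteSite) :
    (fermionTorusGraph 2 (2 * M)).Adj (plaqSite M R a) (plaqSite M R b) ↔ plaquetteGraph.Adj a b := by
  have hL : 3 ≤ 2 * M := by omega
  have ha : ∀ i, (ofLex a i : ℕ) ≤ 1 := fun i => Nat.le_of_lt_succ (ofLex a i).isLt
  have hb : ∀ i, (ofLex b i : ℕ) ≤ 1 := fun i => Nat.le_of_lt_succ (ofLex b i).isLt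
  have hlt : ∀ (c : PlaquetteSite) (i : Fin 2), 2 * (ofLex R i : ℕ) + (ofLex c i : ℕ) < 2 * M := by
    intro c i
    have h1 := two_mul_add_lt R i
    have h2 : (ofLex c i : ℕ) ≤ 1 := Nat.le_of_lt_succ (ofLex c i).isLt
    omega
  -- coordinates in `ZMod L`
  have hcoord : ∀ (c : PlaquetteSite) (i : Fin 2),
      FermionTorus.toTorusSite (plaqSite M R c) i = ((2 * (ofLex R i : ℕ) + (ofLex c i : ℕ) : ℕ) : ZMod (2 * M)) := by
    intro c i
    rw [FermionTorus.toTorusSite_apply, plaqSite_apply_val]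
  -- equality of a coordinate
  have heq : ∀ i, FermionTorus.toTorusSite (plaqSite M R a) i = FermionTorus.toTorusSite (plaqSite M R b) i ↔
      ofLex a i = ofLex b i := by
    intro i
    rw [hcoord, hcoord, natCast_zmod_eq_iff_of_lt (hlt a i) (hlt b i), Fin.ext_iff]
    omega
  -- a `+1` step in coordinate `i`: `y = x + single i 1`
  have hstep : ∀ (c c' : PlaquetteSite) (i : Fin 2),
      FermionTorus.toTorusSite (plaqSite M R c') = FermionTorus.toTorusSite (plaqSite M R c) + Pi.single i 1 ↔
        (ofLex c i : ℕ) = 0 ∧ (ofLex c' i : ℕ) = 1 ∧ ∀ j, j ≠ i → ofLex c' j = ofLex c j := by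
    intro c c' i
    constructor
    · intro h
      have hi := congrFun h i
      rw [Pi.add_apply, Pi.single_eq_same, hcoord, hcoord] at hi
      obtain ⟨h0, h1⟩ := step_in_block hL (two_mul_add_lt R i) (Nat.le_of_lt_succ (ofLex c i).isLt)
        (Nat.le_of_lt_succ (ofLex c' i).isLt) hi
      refine ⟨h0, h1, fun j hj => ?_⟩
      have hj' := congrFun h j
      rw [Pi.add_apply, Pi.single_eq_of_ne hj, add_zero, hcoord, hcoord,
        natCast_zmod_eq_iff_of_lt (hlt c' j) (hlt c j)] at hj'
      apply Fin.ext
      omega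
    · rintro ⟨h0, h1, hrest⟩
      funext j
      rw [Pi.add_apply]
      by_cases hj : j = i
      · subst hj
        rw [Pi.single_eq_same, hcoord, hcoord, h0, h1]
        push_cast
        ring
      · rw [Pi.single_eq_of_ne hj, add_zero, hcoord, hcoord, hrest j hj]
  rw [fermionTorusGraph_adj, torusGraph_adj_iff, plaquetteGraph_adj_iff]
  constructor
  · rintro ⟨hne, hor⟩
    rcases hor with ⟨i, hi⟩ | ⟨i, hi⟩
    · -- `b = a + e_i`: `hrest : ofLex b j = ofLex a j`
      obtain ⟨h0, h1, hrest⟩ := (hstep a b i).1 hi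
      fin_cases i
      · refine Or.inr ⟨fun h => ?_, (hrest 1 (by decide)).symm⟩
        have := congrArg Fin.val h
        simp only [Fin.zero_eta] at h0 h1
        omega
      · refine Or.inl ⟨(hrest 0 (by decide)).symm, fun h => ?_⟩
        have := congrArg Fin.val h
        simp only [Fin.mk_one] at h0 h1
        omega
    · -- `a = b + e_i`: `hrest : ofLex a j = ofLex b j`
      obtain ⟨h0, h1, hrest⟩ := (hstep b a i).1 hi
      fin_cases i
      · refine Or.inr ⟨fun h => ?_, hrest 1 (by decide)⟩
        have := congrArg Fin.val h
        simp only [Fin.zero_eta] at h0 h1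
        omega
      · refine Or.inl ⟨hrest 0 (by decide), fun h => ?_⟩
        have := congrArg Fin.val h
        simp only [Fin.mk_one] at h0 h1
        omega
  · intro hadj
    -- the differing coordinate `i` and the agreeing one
    have key : ∀ i : Fin 2, ofLex a i ≠ ofLex b i → (∀ j, j ≠ i → ofLex a j = ofLex b j) →
        FermionTorus.toTorusSite (plaqSite M R a) ≠ FermionTorus.toTorusSite (plaqSite M R b) ∧
          ((∃ k, FermionTorus.toTorusSite (plaqSite M R b) = FermionTorus.toTorusSite (plaqSite M R a) + Pi.single k 1) ∨
            ∃ k, FermionTorus.toTorusSite (plaqSite M R a) = FermionTorus.toTorusSite (plaqSite M R b) + Pi.single k 1) := by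
      intro i hne hrest
      refine ⟨fun h => hne ((heq i).1 (congrFun h i)), ?_⟩
      have hai := ha i
      have hbi := hb i
      have hne' : (ofLex a i : ℕ) ≠ (ofLex b i : ℕ) := fun h => hne (Fin.ext h)
      by_cases h0 : (ofLex a i : ℕ) = 0
      · left
        exact ⟨i, (hstep a b i).2 ⟨h0, by omega, fun j hj => (hrest j hj).symm⟩⟩
      · right
        exact ⟨i, (hstep b a i).2 ⟨by omega, by omega, fun j hj => hrest j hj⟩⟩
    rcases hadj with ⟨h0, h1⟩ | ⟨h0, h1⟩
    · exact key 1 h1 (fun j hj => by fin_cases j <;> simp_all)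
    · exact key 0 h0 (fun j hj => by fin_cases j <;> simp_all)

/-- **Adjacency inside a plaquette in `G_intra`** (`M ≥ 2`). [cite: YaoTsaiKivelson2007, Fig. 1] -/
theorem intraGraph_adj_plaqSite_iff (hM : 2 ≤ M) (R : FermionTorus 2 M) (a b : PlaquetteSite) :
    plaquetteGraph.Adj a b ↔ (intraGraph M).Adj (plaqSite M R a) (plaqSite M R b) := by
  rw [intraGraph_adj, fermionTorusGraph_adj_plaqSite_iff hM, blockOf_plaqSite, blockOf_plaqSite]
  simp

/-! ### The block cut of the intra-plaquette Hamiltonian -/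

/-- Distinct plaquettes have disjoint site images. [folklore] -/
theorem plaqSite_ne_of_ne {R R' : FermionTorus 2 M} (h : R ≠ R') (a b : PlaquetteSite) :
    plaqSite M R a ≠ plaqSite M R' b := by
  intro h'
  apply h
  rw [← blockOf_plaqSite M R a, h', blockOf_plaqSite]

/-- Every site lies in the image of its plaquette: the plaquette images cover the torus. [folklore] -/
theorem biUnion_map_plaqSiteEmb_eq_univ :
    (Finset.univ.biUnion fun R : FermionTorus 2 M =>
      (Finset.univ : Finset PlaquetteSite).map (plaqSiteEmb M R).toEmbedding) = Finset.univ := by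
  ext x
  simp only [Finset.mem_biUnion, Finset.mem_univ, true_and, Finset.mem_map, RelEmbedding.coe_toEmbedding,
    plaqSiteEmb_apply, iff_true]
  exact ⟨blockOf M x, posOf M x, plaqSite_blockOf_posOf M x⟩

/-- No bond of `G_intra` joins different plaquettes: the intra-plaquette coupling vanishes on every
bond that is not the image of a plaquette bond. [folklore] -/
theorem hubbardCoupling_intraGraph_eq_zero_of_not_mem (t : ℂ) (b : Bond (FermionTorus 2 (2 * M)))
    (hb : b ∉ Finset.univ.biUnion fun R : FermionTorus 2 M =>
      (Finset.univ : Finset (Bond PlaquetteSite)).map ⟨bondMap (plaqSiteEmb M R), bondMap_injective _⟩) :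
    hubbardCoupling (intraGraph M) t b = 0 := by
  obtain ⟨x, y, σ⟩ := b
  rw [hubbardCoupling_apply, if_neg]
  intro hadj
  apply hb
  have hblk : blockOf M x = blockOf M y := intraGraph_adj_imp_blockOf_eq M hadj
  simp only [Finset.mem_biUnion, Finset.mem_univ, true_and, Finset.mem_map, Function.Embedding.coeFn_mk]
  refine ⟨blockOf M x, (posOf M x, posOf M y, σ), ?_⟩
  have hy : plaqSite M (blockOf M x) (posOf M y) = y := by rw [hblk, plaqSite_blockOf_posOf]
  simp only [bondMap, plaqSiteEmb_apply, plaqSite_blockOf_posOf, hy]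

/-- **The intra-plaquette Hamiltonian is the sum of the embedded plaquette Hamiltonians**
(`M ≥ 2`): `hamiltonian G_intra t U = Σ_R jwEmbed (plaqOrbEmb M R) (hamiltonian plaquetteGraph t U)`.
[cite: YaoTsaiKivelson2007, eq. (1)] -/
theorem hamiltonian_intraGraph_eq_sum_jwEmbed (hM : 2 ≤ M) (t U : ℝ) :
    hamiltonian (intraGraph M) t U =
      ∑ R : FermionTorus 2 M, jwEmbed (plaqOrbEmb M R) (hamiltonian plaquetteGraph t U) := by
  have hcut := sourced_sub_sum_jwEmbed_sub_onSiteSum_eq (Finset.univ : Finset (FermionTorus 2 M))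
    (plaqSiteEmb M) (fun R _ R' _ hne x y => plaqSite_ne_of_ne hne x y) (intraGraph M) plaquetteGraph
    (fun R _ x y => intraGraph_adj_plaqSite_iff hM R x y) t U 0 0 0 0 (fun _ _ _ => rfl)
  simp only [Complex.ofReal_zero, zero_smul, sub_zero, hamiltonianWith_zero] at hcut
  have hzero : ∑ b ∈ (Finset.univ.biUnion fun R : FermionTorus 2 M =>
      (Finset.univ : Finset (Bond PlaquetteSite)).map ⟨bondMap (plaqSiteEmb M R), bondMap_injective _⟩)ᶜ,
        hubbardCoupling (intraGraph M) (t : ℂ) b • bondOp b = 0 :=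
    Finset.sum_eq_zero fun b hb => by
      rw [hubbardCoupling_intraGraph_eq_zero_of_not_mem (t : ℂ) b (Finset.mem_compl.1 hb), zero_smul]
  have hrest : onSiteSum (U : ℂ) 0 (Finset.univ.biUnion fun R : FermionTorus 2 M =>
      (Finset.univ : Finset PlaquetteSite).map (plaqSiteEmb M R).toEmbedding)ᶜ = 0 := by
    rw [biUnion_map_plaqSiteEmb_eq_univ, Finset.compl_univ, onSiteSum, Finset.sum_empty]
  simp only [hzero, hrest, neg_zero, sub_zero] at hcut
  exact sub_eq_zero.1 hcut

/-- The summit's intra-plaquette Hamiltonian at `t = 1` is the sum of the embedded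
`plaquetteHamiltonian U`. [cite: YaoTsaiKivelson2007, eq. (1)] -/
theorem hamiltonian_intra_eq_sum_jwEmbed_plaquetteHamiltonian (hM : 2 ≤ M) (U : ℝ) :
    hamiltonian (fermionTorusGraph 2 (2 * M) \
        SimpleGraph.comap (fun x : FermionTorus 2 (2 * M) => fun i : Fin 2 => ((ofLex x) i : ℕ) / 2) ⊤) 1 U =
      ∑ R : FermionTorus 2 M, jwEmbed (plaqOrbEmb M R) (plaquetteHamiltonian U) := by
  have h := hamiltonian_intraGraph_eq_sum_jwEmbed hM 1 U
  exact h

end TorusPlaquette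

end Literature.MathematicalPhysics.QuantumLattice

end
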